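import Literature.NumberTheory.Transcendental.NesterenkoChowFormHypersurface
import Literature.NumberTheory.Transcendental.NesterenkoEliminationCor410Proofs
import Mathlib.LinearAlgebra.Matrix.Block
import HarnessLib

/-!
# Coefficient norms of polynomials and the size of `P(Δ)` (LNM 1752 Ch. 3 §4, towards Prop. 4.8)

Topic `Literature/NumberTheory/Transcendental`. Elementary estimates used in the proof of
LNM 1752 Ch. 3 Proposition 4.8 (`NesterenkoEliminationFacts2Proofs.lean`):

* complements to the `ℓ¹`-norm `l1Norm` of `NesterenkoEliminationNorms.lean` and to `maxNorm`
  (Definition 4.1): the determinant bound `l1Norm_det_le`, monotonicity under substitution of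
  signed variables (`l1Norm_aeval_le`), `|c f| = |c| |f|` and `|X_v f| = |f|`;
* counting monomials: a homogeneous polynomial of degree `d` in `m + 1` variables has at most
  `(m+1)^d` monomials (`card_support_le_pow_of_isHomogeneous`), and `P(Δ)` — which is homogeneous of
  degree `d` in each row `u_i` of `U` (`hyperChow_isWeightedHomogeneous_row`) — has at most
  `(m+1)^{md}` (`card_support_hyperChow_le`); in particular `deg_{u_1} P(Δ) = d`
  (`blockDeg_hyperChow`);
* the specialisation `U ↦ U(t)` with rows `t_{i+1} e_i − t_i e_{i+1}` (all orthogonal to `t̄`),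
  under which `Δ(U(t)) ∥ t̄` and `t_0^d · P(Δ)(U(t)) = Δ_0(U(t))^d · P(t̄)` with
  `Δ_0(U(t)) = ± t_0 ⋯ t_{m−1}` (`specialise_hyperChow`): hence `P(Δ) ≠ 0`
  (`hyperChow_ne_zero`) and `|P| ≤ #supp P(Δ) · |P(Δ)|` (`maxNorm_le_card_mul_maxNorm_hyperChow`).

Everything here is proved; nothing is cited beyond the definitions of Ch. 3 §4.

## References

* [NesterenkoPhilippon2001] LNM 1752 (2001), Ch. 3 §4, Def. 4.1, Def. 4.5, Prop. 4.8 (p. 40).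
-/

noncomputable section

open MvPolynomial Matrix Pointwise

namespace Literature.NumberTheory.Transcendental

namespace Nesterenko

/-! ### The `ℓ¹`-norm of the coefficients -/

section L1

variable {σ K : Type*} [NormedField K]

/-- Each coefficient is bounded by `‖f‖₁`. [folklore] -/
theorem norm_coeff_le_l1Norm (f : MvPolynomial σ K) (β : σ →₀ ℕ) : ‖f.coeff β‖ ≤ l1Norm f := by
  classical
  by_cases h : β ∈ f.support
  · exact Finset.single_le_sum (f := fun β => ‖f.coeff β‖) (fun _ _ => norm_nonneg _) h
  · rw [notMem_support_iff.mp h, norm_zero]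
    exact l1Norm_nonneg f

/-- `‖C a · f‖₁ ≤ |a| ‖f‖₁`. [folklore] -/
theorem l1Norm_C_mul_le (a : K) (f : MvPolynomial σ K) : l1Norm (C a * f) ≤ ‖a‖ * l1Norm f :=
  (l1Norm_mul_le _ _).trans (by rw [l1Norm_C])

/-- `‖±f‖₁ = ‖f‖₁` for a sign `±1 ∈ ℤˣ`. [folklore] -/
theorem l1Norm_units_smul (u : ℤˣ) (f : MvPolynomial σ K) : l1Norm (u • f) = l1Norm f := by
  rcases Int.units_eq_one_or u with rfl | rfl
  · rw [one_smul]
  · rw [Units.smul_def, Units.val_neg, Units.val_one, neg_smul, one_smul, l1Norm_neg]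

/-- **Determinant bound**: if every entry of an `n × n` matrix of polynomials has `‖·‖₁ ≤ B`,
then `‖det‖₁ ≤ n! Bⁿ`. [folklore] -/
theorem l1Norm_det_le {n : Type*} [Fintype n] [DecidableEq n]
    (M : Matrix n n (MvPolynomial σ K)) {B : ℝ} (hB : ∀ i j, l1Norm (M i j) ≤ B) :
    l1Norm M.det ≤ (Fintype.card n).factorial * B ^ Fintype.card n := by
  rw [Matrix.det_apply]
  refine (l1Norm_sum_le _ _).trans ?_
  calc ∑ τ : Equiv.Perm n, l1Norm (Equiv.Perm.sign τ • ∏ i, M (τ i) i)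
      ≤ ∑ _τ : Equiv.Perm n, B ^ Fintype.card n := by
        refine Finset.sum_le_sum fun τ _ => ?_
        rw [l1Norm_units_smul]
        refine (l1Norm_prod_le _ _).trans ?_
        calc ∏ i, l1Norm (M (τ i) i) ≤ ∏ _i : n, B :=
              Finset.prod_le_prod (fun _ _ => l1Norm_nonneg _) fun i _ => hB _ _
          _ = B ^ Fintype.card n := by simp
    _ = (Fintype.card n).factorial * B ^ Fintype.card n := by
        rw [Finset.sum_const, nsmul_eq_mul, Finset.card_univ, Fintype.card_perm]

/-- **Substitution bound**: `‖f(g_1, …)‖₁ ≤ ∑_β |f_β| ∏_v ‖g_v‖₁^{β_v}`. [folklore] -/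
theorem l1Norm_aeval_le_sum {τ : Type*} (g : σ → MvPolynomial τ K)
    (f : MvPolynomial σ K) :
    l1Norm (aeval g f) ≤ ∑ β ∈ f.support, ‖f.coeff β‖ * ∏ v ∈ β.support, l1Norm (g v) ^ β v := by
  classical
  conv_lhs => rw [f.as_sum, map_sum]
  refine (l1Norm_sum_le _ _).trans (Finset.sum_le_sum fun β _ => ?_)
  rw [aeval_monomial, ← C_eq_algebraMap]
  refine (l1Norm_C_mul_le _ _).trans (mul_le_mul_of_nonneg_left ?_ (norm_nonneg _))
  rw [Finsupp.prod]
  refine (l1Norm_prod_le _ _).trans (Finset.prod_le_prod (fun _ _ => l1Norm_nonneg _) ?_)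
  exact fun v _ => l1Norm_pow_le _ _

/-- Substituting polynomials of `ℓ¹`-norm at most `1` (e.g. `0` or signed variables) does not
increase the `ℓ¹`-norm. [folklore] -/
theorem l1Norm_aeval_le {τ : Type*} {g : σ → MvPolynomial τ K}
    (hg : ∀ v, l1Norm (g v) ≤ 1) (f : MvPolynomial σ K) : l1Norm (aeval g f) ≤ l1Norm f := by
  refine (l1Norm_aeval_le_sum g f).trans ?_
  rw [l1Norm]
  refine Finset.sum_le_sum fun β _ => ?_
  refine mul_le_of_le_one_right (norm_nonneg _) (Finset.prod_le_one (fun _ _ => ?_) fun v _ => ?_)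
  · exact pow_nonneg (l1Norm_nonneg _) _
  · exact pow_le_one₀ (l1Norm_nonneg _) (hg v)

end L1

/-! ### `maxNorm` (Definition 4.1) versus `l1Norm` -/

section MaxNorm

variable {σ K : Type*} [NormedField K]

/-- `|C a · f| = |a| · |f|`. [folklore] -/
theorem maxNorm_C_mul (a : K) (f : MvPolynomial σ K) : maxNorm (C a * f) = ‖a‖ * maxNorm f := by
  by_cases ha : a = 0
  · subst ha; simp
  refine le_antisymm (maxNorm_C_mul_le a f) ?_
  rw [← le_div_iff₀' (norm_pos_iff.mpr ha)]
  refine maxNorm_le_of_forall_le (div_nonneg (maxNorm_nonneg _) (norm_nonneg _)) fun β _ => ?_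
  rw [le_div_iff₀' (norm_pos_iff.mpr ha), ← norm_mul, ← coeff_C_mul]
  exact norm_coeff_le_maxNorm _ β

/-- Multiplication by a variable permutes the coefficients: `|X_v f| = |f|`. [folklore] -/
theorem maxNorm_X_mul (v : σ) (f : MvPolynomial σ K) : maxNorm (X v * f) = maxNorm f := by
  classical
  refine le_antisymm (maxNorm_le_of_forall_le (maxNorm_nonneg _) fun β _ => ?_)
    (maxNorm_le_of_forall_le (maxNorm_nonneg _) fun β _ => ?_)
  · rw [coeff_X_mul']
    split_ifs
    · exact norm_coeff_le_maxNorm f _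
    · rw [norm_zero]; exact maxNorm_nonneg _
  · have : (X v * f).coeff (Finsupp.single v 1 + β) = f.coeff β := by
      rw [X, coeff_monomial_mul, one_mul]
    rw [← this]
    exact norm_coeff_le_maxNorm _ _

/-- `|g f| = |f|` whenever `g` is a product of signed variables. [folklore] -/
theorem maxNorm_prod_neg_X_pow_mul {ι : Type*} (s : Finset ι) (v : ι → σ) (d : ℕ)
    (f : MvPolynomial σ K) : maxNorm ((∏ i ∈ s, -X (v i)) ^ d * f) = maxNorm f := by
  classical
  -- the class of `g` with `|g f| = |f|` for all `f` is multiplicatively closed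
  have key : ∀ g : MvPolynomial σ K, (g = 1 ∨ ∃ i, g = -X (v i)) →
      ∀ f : MvPolynomial σ K, maxNorm (g * f) = maxNorm f := by
    rintro g (rfl | ⟨i, rfl⟩) f
    · rw [one_mul]
    · rw [neg_mul, maxNorm_neg, maxNorm_X_mul]
  have hprod : ∀ f : MvPolynomial σ K, maxNorm ((∏ i ∈ s, -X (v i)) * f) = maxNorm f := by
    refine Finset.prod_induction (p := fun g => ∀ f : MvPolynomial σ K,
      maxNorm (g * f) = maxNorm f) _ ?_ ?_ ?_
    · intro a b ha hb f
      rw [mul_assoc, ha, hb]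
    · intro f; rw [one_mul]
    · intro i _ f
      exact key _ (Or.inr ⟨i, rfl⟩) f
  induction d generalizing f with
  | zero => rw [pow_zero, one_mul]
  | succ d ih => rw [pow_succ, mul_assoc, ih, hprod]

end MaxNorm

/-- `|X_v^d f| = |f|`. [folklore] -/
theorem maxNorm_X_pow_mul {σ K : Type*} [NormedField K] (v : σ) (d : ℕ) (f : MvPolynomial σ K) :
    maxNorm (X v ^ d * f) = maxNorm f := by
  induction d generalizing f with
  | zero => rw [pow_zero, one_mul]
  | succ d ih => rw [pow_succ, mul_assoc, ih, maxNorm_X_mul]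

/-! ### Counting monomials -/

section Counting

/-- The exponent `X_{w(0)} ⋯ X_{w(d−1)}` of the word `w`. [folklore] -/
def wordMonomial (n d : ℕ) (w : Fin d → Fin n) : Fin n →₀ ℕ :=
  ∑ k, Finsupp.single (w k) 1

/-- The exponents of degree `d` in `n` variables, enumerated (with repetitions) by the words of
length `d`. [folklore] -/
def degMonomials (n d : ℕ) : Finset (Fin n →₀ ℕ) :=
  Finset.univ.image (wordMonomial n d)

/-- There are at most `n^d` monomials of degree `d` in `n` variables. [folklore] -/
theorem card_degMonomials_le (n d : ℕ) : (degMonomials n d).card ≤ n ^ d :=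
  Finset.card_image_le.trans (by simp)

/-- Every exponent of degree `d` is the exponent of a word of length `d`. [folklore] -/
theorem exists_word_of_degree_eq {n : ℕ} : ∀ (d : ℕ) (γ : Fin n →₀ ℕ), γ.degree = d →
    ∃ w : Fin d → Fin n, γ = wordMonomial n d w := by
  intro d
  induction d with
  | zero =>
    intro γ h
    rw [Finsupp.degree_eq_zero_iff] at h
    exact ⟨Fin.elim0, by simp [h, wordMonomial]⟩
  | succ d ih =>
    intro γ h
    have hγ : γ ≠ 0 := by
      rintro rfl
      simp at h
    obtain ⟨i, hi⟩ := Finsupp.support_nonempty_iff.mpr hγ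
    have hle : Finsupp.single i 1 ≤ γ :=
      Finsupp.single_le_iff.mpr (Nat.one_le_iff_ne_zero.mpr (Finsupp.mem_support_iff.mp hi))
    have hγ' : γ = Finsupp.single i 1 + (γ - Finsupp.single i 1) :=
      (add_tsub_cancel_of_le hle).symm
    have hdeg : (γ - Finsupp.single i 1).degree = d := by
      have := congrArg Finsupp.degree hγ'
      rw [map_add, Finsupp.degree_single, h] at this
      omega
    obtain ⟨w', hw'⟩ := ih _ hdeg
    refine ⟨Fin.cons i w', ?_⟩
    rw [wordMonomial, Fin.sum_univ_succ, Fin.cons_zero]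
    simp only [Fin.cons_succ]
    rw [wordMonomial] at hw'
    rw [← hw']
    exact hγ'

/-- Exponents of degree `d` lie in `degMonomials n d`. [folklore] -/
theorem mem_degMonomials {n d : ℕ} {γ : Fin n →₀ ℕ} (h : γ.degree = d) :
    γ ∈ degMonomials n d := by
  obtain ⟨w, rfl⟩ := exists_word_of_degree_eq d γ h
  exact Finset.mem_image_of_mem _ (Finset.mem_univ w)

/-- The support of a homogeneous polynomial of degree `d` consists of exponents of degree `d`.
[folklore] -/
theorem support_subset_degMonomials_of_isHomogeneous {K : Type*} [CommSemiring K] {n d : ℕ}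
    {P : MvPolynomial (Fin n) K} (hP : P.IsHomogeneous d) : P.support ⊆ degMonomials n d := by
  intro γ hγ
  refine mem_degMonomials ?_
  rw [hP.degree_eq_sum_deg_support hγ]
  rfl

/-- **A homogeneous polynomial of degree `d` in `n` variables has at most `n^d` monomials.**
[folklore] -/
theorem card_support_le_pow_of_isHomogeneous {K : Type*} [CommSemiring K] {n d : ℕ}
    {P : MvPolynomial (Fin n) K} (hP : P.IsHomogeneous d) : P.support.card ≤ n ^ d :=
  (Finset.card_le_card (support_subset_degMonomials_of_isHomogeneous hP)).trans
    (card_degMonomials_le n d)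

end Counting

/-! ### `P(Δ)` is homogeneous of degree `deg P` in each row of `U` -/

section Rows

variable {m : ℕ}

/-- The weight "degree in the row `u_i`": `1` on the variables `u_{ij}`, `0` elsewhere.
[cite: NesterenkoPhilippon2001, Ch. 3 Def. 4.5 (p. 38)] -/
def rowWeight (m i : ℕ) (v : Fin m × Fin (m + 1)) : ℕ :=
  if (v.1 : ℕ) = i then 1 else 0

/-- The `rowWeight i`-weight of an exponent `β` is `∑_j β(i, j)`. [folklore] -/
theorem weight_rowWeight (i : Fin m) (β : Fin m × Fin (m + 1) →₀ ℕ) :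
    Finsupp.weight (rowWeight m i) β = ∑ j, β (i, j) := by
  rw [Finsupp.weight_apply, Finsupp.sum_fintype _ _ (by simp)]
  simp only [rowWeight, smul_eq_mul, mul_ite, mul_one, mul_zero]
  rw [Fintype.sum_prod_type]
  simp only [Fin.val_eq_val]
  rw [Finset.sum_comm]
  simp [Finset.sum_ite_eq']

/-- Each signed maximal minor `Δ_j` of the generic matrix is linear in every row `u_i`.
[folklore] -/
theorem genDelta_isWeightedHomogeneous_row (i : Fin m) (j : Fin (m + 1)) :
    IsWeightedHomogeneous (rowWeight m i) (genDelta m j) 1 := by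
  have hN : ∀ τ : Equiv.Perm (Fin m), IsWeightedHomogeneous (rowWeight m i)
      (∏ c, ((mvPolynomialX (Fin m) (Fin (m + 1)) ℚ).submatrix id j.succAbove) (τ c) c) 1 := by
    intro τ
    have h := IsWeightedHomogeneous.prod (R := ℚ) (w := rowWeight m i) Finset.univ
      (fun c : Fin m => (X (τ c, j.succAbove c) : RU m m))
      (fun c => rowWeight m i (τ c, j.succAbove c)) fun c _ => isWeightedHomogeneous_X ℚ _ _
    have hsum : ∑ c, rowWeight m i (τ c, j.succAbove c) = 1 := by
      simp only [rowWeight]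
      rw [Equiv.sum_comp τ (fun a : Fin m => if (a : ℕ) = i then 1 else 0)]
      simp [Fin.val_eq_val, Finset.sum_ite_eq']
    rw [hsum] at h
    exact h
  have hdet : IsWeightedHomogeneous (rowWeight m i)
      ((mvPolynomialX (Fin m) (Fin (m + 1)) ℚ).submatrix id j.succAbove).det 1 := by
    rw [Matrix.det_apply]
    refine IsWeightedHomogeneous.sum _ _ _ fun τ _ => ?_
    rw [Units.smul_def, ← Int.cast_smul_eq_zsmul ℚ, ← C_mul']
    have := (isWeightedHomogeneous_C (rowWeight m i)
      (((Equiv.Perm.sign τ : ℤˣ) : ℤ) : ℚ)).mul (hN τ)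
    rwa [zero_add] at this
  rw [genDelta, maxMinor]
  have hs : IsWeightedHomogeneous (rowWeight m i) ((-1 : RU m m) ^ (j : ℕ)) 0 := by
    have := (isWeightedHomogeneous_C (σ := Fin m × Fin (m + 1)) (rowWeight m i)
      ((-1 : ℚ) ^ (j : ℕ)))
    rwa [C_pow, C_neg, C_1] at this
  have := hs.mul hdet
  rwa [zero_add] at this

/-- Substituting weight-`1` polynomials into a homogeneous polynomial of degree `d` gives a
weight-`d` polynomial. [folklore] -/
theorem IsWeightedHomogeneous.aeval_of_isHomogeneous {σ τ M : Type*} [AddCommMonoid M]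
    {w : τ → M} {n : M} {g : σ → MvPolynomial τ ℚ} (hg : ∀ v, IsWeightedHomogeneous w (g v) n)
    {P : MvPolynomial σ ℚ} {d : ℕ} (hP : P.IsHomogeneous d) :
    IsWeightedHomogeneous w (aeval g P) (d • n) := by
  classical
  rw [P.as_sum, map_sum]
  refine IsWeightedHomogeneous.sum _ _ _ fun γ hγ => ?_
  rw [aeval_monomial, ← C_eq_algebraMap]
  refine IsWeightedHomogeneous.C_mul ?_ _
  rw [Finsupp.prod, hP.degree_eq_sum_deg_support hγ, Finset.sum_smul]
  refine IsWeightedHomogeneous.prod _ _ _ fun v _ => ?_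
  exact (hg v).pow _

/-- **`P(Δ)` is homogeneous of degree `d = deg P` in each row `u_i`.**
[cite: NesterenkoPhilippon2001, Ch. 3 Prop. 4.8 1) (p. 40)] -/
theorem hyperChow_isWeightedHomogeneous_row {P : Rx m} {d : ℕ} (hP : P.IsHomogeneous d)
    (i : Fin m) : IsWeightedHomogeneous (rowWeight m i) (hyperChow P) d := by
  have h := IsWeightedHomogeneous.aeval_of_isHomogeneous
    (genDelta_isWeightedHomogeneous_row i) hP
  rw [smul_eq_mul, mul_one] at h
  exact h

/-- Every monomial of `P(Δ)` has degree `d` in each row. [folklore] -/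
theorem sum_eq_of_mem_support_hyperChow {P : Rx m} {d : ℕ} (hP : P.IsHomogeneous d)
    {β : Fin m × Fin (m + 1) →₀ ℕ} (hβ : β ∈ (hyperChow P).support) (i : Fin m) :
    ∑ j, β (i, j) = d := by
  rw [← weight_rowWeight]
  exact hyperChow_isWeightedHomogeneous_row hP i (mem_support_iff.mp hβ)

/-- **`deg_{u_1} P(Δ) = deg P`** (for `P(Δ) ≠ 0`). [cite: NesterenkoPhilippon2001, Ch. 3
Prop. 4.8 1) (p. 40)] -/
theorem blockDeg_hyperChow {P : Rx m} {d : ℕ} (hP : P.IsHomogeneous d) (hF : hyperChow P ≠ 0)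
    (i : Fin m) : blockDeg (hyperChow P) i = d := by
  rw [blockDeg]
  refine le_antisymm (Finset.sup_le fun β hβ => (sum_eq_of_mem_support_hyperChow hP hβ i).le) ?_
  obtain ⟨β, hβ⟩ := support_nonempty.mpr hF
  exact (sum_eq_of_mem_support_hyperChow hP hβ i).ge.trans
    (Finset.le_sup (f := fun e : Fin m × Fin (m + 1) →₀ ℕ => ∑ j, e (i, j)) hβ)

/-- **`P(Δ)` has at most `(m+1)^{md}` monomials.** [folklore] -/
theorem card_support_hyperChow_le {P : Rx m} {d : ℕ} (hP : P.IsHomogeneous d) :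
    (hyperChow P).support.card ≤ (m + 1) ^ (m * d) := by
  have hrow : ∀ β ∈ (hyperChow P).support, ∀ i : Fin m,
      Finsupp.curry β i ∈ degMonomials (m + 1) d := by
    intro β hβ i
    refine mem_degMonomials ?_
    rw [← sum_eq_of_mem_support_hyperChow hP hβ i, Finsupp.degree_eq_sum]
    rfl
  calc (hyperChow P).support.card
      ≤ (Fintype.piFinset fun _ : Fin m => degMonomials (m + 1) d).card := by
        refine Finset.card_le_card_of_injOn (fun β i => Finsupp.curry β i)
          (fun β hβ => Fintype.mem_piFinset.mpr (hrow β hβ)) ?_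
        intro β _ β' _ h
        ext ⟨i, j⟩
        have := congrFun h i
        simp only at this
        rw [← Finsupp.curry_apply β i j, ← Finsupp.curry_apply β' i j, this]
    _ ≤ (m + 1) ^ (m * d) := by
        rw [Fintype.card_piFinset, Finset.prod_const, Finset.card_univ, Fintype.card_fin,
          mul_comm m d, pow_mul]
        exact Nat.pow_le_pow_left (card_degMonomials_le _ _) _

end Rows

/-! ### The specialisation `U ↦ U(t)` -/

section Specialise

variable {m : ℕ}

/-- Row `i` of `U(t)`: `t_{i+1} e_i − t_i e_{i+1}` (orthogonal to `t̄ = (t_0, …, t_m)`).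
[folklore] -/
def specRow (m : ℕ) (i : Fin m) : Fin (m + 1) → Rx m :=
  Pi.single (Fin.castSucc i) (X i.succ) - Pi.single i.succ (X (Fin.castSucc i))

/-- The matrix `U(t)`. [folklore] -/
def specMat (m : ℕ) : Matrix (Fin m) (Fin (m + 1)) (Rx m) :=
  Matrix.of (specRow m)

/-- The substitution `u_{ij} ↦ U(t)_{ij}`, `ℚ[U] → ℚ[t_0, …, t_m]`. [folklore] -/
def specialise (m : ℕ) : RU m m →ₐ[ℚ] Rx m :=
  aeval fun v => specMat m v.1 v.2

/-- `specialise` unfolded. [folklore] -/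
theorem specialise_apply (F : RU m m) :
    specialise m F = aeval (fun v : Fin m × Fin (m + 1) => specMat m v.1 v.2) F := rfl

/-- `U(t) t̄ = 0`. [folklore] -/
theorem specMat_mulVec_X : specMat m *ᵥ (fun j => X j) = 0 := by
  funext i
  change specRow m i ⬝ᵥ (fun j => X j) = 0
  rw [specRow, sub_dotProduct, single_dotProduct, single_dotProduct]
  ring

/-- `Δ_j(U(t))` is the specialisation of `Δ_j`. [folklore] -/
theorem specialise_genDelta (j : Fin (m + 1)) :
    specialise m (genDelta m j) = maxMinor (specMat m) j := by
  rw [genDelta, specialise, show (aeval fun v : Fin m × Fin (m + 1) => specMat m v.1 v.2)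
      (maxMinor (mvPolynomialX (Fin m) (Fin (m + 1)) ℚ) j) =
      (aeval fun v : Fin m × Fin (m + 1) => specMat m v.1 v.2).toRingHom
        (maxMinor (mvPolynomialX (Fin m) (Fin (m + 1)) ℚ) j) from rfl, map_maxMinor]
  congr 1
  ext i k
  simp [mvPolynomialX]

/-- `Δ_0(U(t)) = (−t_0) ⋯ (−t_{m−1})` (a lower triangular determinant). [folklore] -/
theorem maxMinor_specMat_zero : maxMinor (specMat m) 0 = ∏ i : Fin m, -X (Fin.castSucc i) := by
  rw [maxMinor, Fin.val_zero, pow_zero, one_mul, Matrix.det_of_lowerTriangular _ ?_]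
  · refine Finset.prod_congr rfl fun i _ => ?_
    simp [specMat, specRow, (Fin.castSucc_lt_succ (i := i)).ne']
  · intro i c hlt
    replace hlt : i < c := hlt
    have h1 : c.succ ≠ Fin.castSucc i := by
      intro h
      have := congrArg Fin.val h
      simp only [Fin.val_succ, Fin.val_castSucc] at this
      have := hlt; rw [Fin.lt_def] at this
      omega
    have h2 : c.succ ≠ i.succ := fun h => hlt.ne' (Fin.succ_inj.mp h)
    simp [specMat, specRow, h1, h2]

/-- `(−t_0) ⋯ (−t_{m−1}) ≠ 0`. [folklore] -/
theorem prod_neg_X_castSucc_ne_zero : (∏ i : Fin m, -X (Fin.castSucc i) : Rx m) ≠ 0 :=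
  Finset.prod_ne_zero_iff.mpr fun _ _ => neg_ne_zero.mpr (X_ne_zero _)

/-- **The specialisation identity**: `t_0^d · P(Δ)(U(t)) = Δ_0(U(t))^d · P(t̄)` for `P`
homogeneous of degree `d` (because `Δ(U(t))` is proportional to `t̄`). [folklore] -/
theorem specialise_hyperChow {P : Rx m} {d : ℕ} (hP : P.IsHomogeneous d) :
    X 0 ^ d * specialise m (hyperChow P) = maxMinor (specMat m) 0 ^ d * P := by
  rw [hyperChow, map_aeval_eq]
  simp_rw [specialise_genDelta]
  rw [← aeval_mul_of_isHomogeneous hP (X 0) (maxMinor (specMat m))]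
  have : (fun j => X 0 * maxMinor (specMat m) j) = fun j => maxMinor (specMat m) 0 * X j := by
    funext j
    rw [mul_comm]
    exact (maxMinor_mul_eq_of_mulVec_eq_zero (specMat m) (fun j => X j) specMat_mulVec_X j 0).symm
  rw [this, aeval_mul_of_isHomogeneous hP, aeval_X_left_apply]

/-- **`P(Δ) ≠ 0`** for `P ≠ 0` homogeneous: the maximal minors of the generic matrix are
algebraically independent enough. [cite: NesterenkoPhilippon2001, Ch. 3 Prop. 4.8 1) (p. 40)] -/
theorem hyperChow_ne_zero {P : Rx m} {d : ℕ} (hP : P.IsHomogeneous d) (hP0 : P ≠ 0) :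
    hyperChow P ≠ 0 := by
  intro h
  have := specialise_hyperChow hP (m := m)
  rw [h, map_zero, mul_zero] at this
  exact mul_ne_zero (pow_ne_zero _ (maxMinor_specMat_zero (m := m) ▸ prod_neg_X_castSucc_ne_zero))
    hP0 this.symm

/-- The entries of `U(t)` are `0` or signed variables: `‖U(t)_{ij}‖₁ ≤ 1`. [folklore] -/
theorem l1Norm_specMat_le (i : Fin m) (j : Fin (m + 1)) : l1Norm (specMat m i j) ≤ 1 := by
  have hne : Fin.castSucc i ≠ i.succ := (Fin.castSucc_lt_succ (i := i)).ne
  simp only [specMat, Matrix.of_apply, specRow, Pi.sub_apply, Pi.single_apply]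
  by_cases h1 : j = Fin.castSucc i
  · subst h1
    simp [hne, l1Norm_X]
  · by_cases h2 : j = i.succ
    · subst h2
      simp only [h1, if_false, if_true, zero_sub]
      rw [l1Norm_neg, l1Norm_X]
    · simp [h1, h2]

/-- **`|P| ≤ #supp P(Δ) · |P(Δ)|`**: the coefficients of `P` are recovered from those of `P(Δ)`
by the specialisation `U ↦ U(t)`. [folklore] -/
theorem maxNorm_le_card_mul_maxNorm_hyperChow {P : Rx m} {d : ℕ} (hP : P.IsHomogeneous d) :
    maxNorm P ≤ (hyperChow P).support.card * maxNorm (hyperChow P) :=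
  calc maxNorm P = maxNorm (maxMinor (specMat m) 0 ^ d * P) := by
        rw [maxMinor_specMat_zero, maxNorm_prod_neg_X_pow_mul]
    _ = maxNorm (specialise m (hyperChow P)) := by
        rw [← specialise_hyperChow hP, maxNorm_X_pow_mul]
    _ ≤ l1Norm (specialise m (hyperChow P)) := maxNorm_le_l1Norm _
    _ ≤ l1Norm (hyperChow P) := by
        rw [specialise_apply]
        refine l1Norm_aeval_le ?_ _
        intro v
        have h := l1Norm_specMat_le (m := m) v.1 v.2
        exact h
    _ ≤ (hyperChow P).support.card * maxNorm (hyperChow P) := l1Norm_le_card_mul_maxNorm _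

end Specialise

end Nesterenko

end Literature.NumberTheory.Transcendental

end
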